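import Literature.AlgebraicGeometry.Motives.CartierDivisor
import Literature.AlgebraicGeometry.Motives.ProjectiveDescentNormProofs
import HarnessLib

/-!
# Rational functions on an integral scheme, read on an affine chart

The dictionary between the concrete language of `Motives/CartierDivisor` (a rational function
`h ∈ K(X)` on the integral scheme `X` is *regular* / *a unit* at `x` iff `h ∈ 𝒪_{X,x}` /
`h ∈ 𝒪_{X,x}^×`, `RatFn.IsRegularAt`, `RatFn.IsUnitAt`) and commutative algebra on an affine open
`V = Spec S`, `S = Γ(X, V) ⊆ K(X)`: for `y ∈ V` with prime `𝔭_y ⊂ S` (Mathlib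
`IsAffineOpen.primeIdealOf`), `𝒪_{X,y} = S_{𝔭_y}` inside `K(X)` (Mathlib
`IsAffineOpen.isLocalization_stalk`; Görtz–Wedhorn I, (2.10.2) and Prop. 3.29 (1)), so that

* `isUnitAt_algebraMap_iff` — a section `a ∈ S` is a unit at `y` iff `a ∉ 𝔭_y`;
* `isRegularAt_iff_exists` — `h` is regular at `y` iff `h = a / b` with `a, b ∈ S`, `b ∉ 𝔭_y`;
* `vanishingIdeal_ideal_le_iff`, `vanishingIdeal_ideal_le_primeIdealOf_iff` — for a closed
  `Z ⊆ X` and Mathlib's radical ideal `J_V(Z) = I(Z ∩ V) ⊆ S` of `Z` on the chart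
  (`(Scheme.IdealSheafData.vanishingIdeal Z).ideal ⟨V, hV⟩`), `J_V(Z) ⊆ 𝔭_y ↔ y ∈ Z`
  (Görtz–Wedhorn I, Prop. 2.3 (2): `V(I(Y)) = Ȳ`);
* `fromSpec_comap` — points versus primes along a smaller affine `W ⊆ V`
  (naturality of `fromSpec`, Mathlib `IsAffineOpen.map_fromSpec`);
* `mem_of_forall_isRegularAt` — if every section over the affine `W ⊆ V` is regular at
  `y ∈ V`, then `y ∈ W` (the prime of `Γ(X, W)` of non-units at `y` lies over `𝔭_y`).

All statements take the point as `y : V` so that Mathlib's instances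
`Algebra Γ(X, V) 𝒪_{X,y}`, `IsScalarTower Γ(X, V) 𝒪_{X,y} K(X)` apply verbatim. The
points-versus-primes helpers `FieldNorm.fromSpec_mem`, `FieldNorm.primeIdealOf_fromSpec` of
`Motives/ProjectiveDescentNormProofs` are reused. Used in `Motives/CartierDivisorOfComplement`
(Görtz–Wedhorn II, Lemma 25.150 from Auslander–Buchsbaum).

Mathlib searched (pin): `IsAffineOpen.isLocalization_stalk`, `IsAffineOpen.primeIdealOf`,
`IsAffineOpen.fromSpec_primeIdealOf`, `IsAffineOpen.map_fromSpec`,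
`Scheme.algebraMap_germ_eq_germToFunctionField`, `functionField_isScalarTower`,
`TopCat.Presheaf.stalk_open_algebraMap`, `IsLocalization.AtPrime.isUnit_to_map_iff`,
`IsLocalization.AtPrime.to_map_mem_maximal_iff`, `Scheme.IdealSheafData.vanishingIdeal` with
`vanishingIdeal_ideal` (the ideal of a closed subset on an affine chart — used, not redefined),
`PrimeSpectrum.zeroLocus_vanishingIdeal_eq_closure` (all used).

## References

* U. Görtz, T. Wedhorn, *Algebraic Geometry I: Schemes*, 2nd ed., Springer Spektrum (2020),
  doi:10.1007/978-3-658-30733-2: Prop. 2.3 (2) (`I(V(𝔞)) = rad 𝔞`, `V(I(Y)) = Ȳ`), (2.10.2)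
  (`𝒪_{Spec A,x} = A_{𝔭_x}`), Def. 3.28 – Prop. 3.29 (p. 102: function field, `Γ(U, 𝒪) ⊆ K(X)`,
  `𝒪_{X,x} ⊆ K(X)`). [GortzWedhorn2020]
-/

universe u

open CategoryTheory AlgebraicGeometry TopologicalSpace Opposite

noncomputable section

namespace Literature.AlgebraicGeometry.Motives.RatFn

variable {X : Scheme.{u}} [IsIntegral X] {V : X.Opens} (hV : IsAffineOpen V)

/-! ### Units and regular functions at a point of an affine chart -/

omit [IsIntegral X] in
/-- `Γ(X, V) → 𝒪_{X,y}` is the germ map. [folklore] -/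
theorem algebraMap_stalk_eq_germ (y : V) (a : Γ(X, V)) :
    algebraMap Γ(X, V) (X.presheaf.stalk y) a = X.presheaf.germ V y y.2 a := by
  rw [TopCat.Presheaf.stalk_open_algebraMap]

/-- A rational function given by an element of `𝒪_{X,y}` is a unit at `y` iff that element is a
unit. [folklore] -/
theorem isUnitAt_toFunctionField_iff {y : X} (t : X.presheaf.stalk y) :
    IsUnitAt y (toFunctionField y t) ↔ IsUnit t :=
  ⟨fun ⟨u, hu⟩ => toFunctionField_injective y hu ▸ u.isUnit, fun h => ⟨h.unit, rfl⟩⟩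

section Sections

variable [Nonempty V]

/-- The rational function of a section is its germ, read in `K(X)` (independently of the point;
Görtz–Wedhorn I, Prop. 3.29 (2)). [folklore] -/
theorem toFunctionField_algebraMap_stalk (y : V) (a : Γ(X, V)) :
    toFunctionField (y : X) (algebraMap Γ(X, V) (X.presheaf.stalk y) a) =
      algebraMap Γ(X, V) X.functionField a :=
  (IsScalarTower.algebraMap_apply Γ(X, V) (X.presheaf.stalk y) X.functionField a).symm

/-- `Γ(X, V) → K(X)` is injective (`X` integral). [folklore] -/
theorem algebraMap_injective : Function.Injective (algebraMap Γ(X, V) X.functionField) :=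
  X.germToFunctionField_injective V

/-- A nonzero section is a nonzero rational function. [folklore] -/
theorem algebraMap_ne_zero_iff {a : Γ(X, V)} : algebraMap Γ(X, V) X.functionField a ≠ 0 ↔ a ≠ 0 :=
  (map_ne_zero_iff _ algebraMap_injective)

/-- `Γ(X, V) → 𝒪_{X,y}` is injective (`X` integral). [folklore] -/
theorem algebraMap_stalk_injective (y : V) :
    Function.Injective (algebraMap Γ(X, V) (X.presheaf.stalk y)) := fun a b h =>
  algebraMap_injective (V := V) (by
    rw [← toFunctionField_algebraMap_stalk y a, ← toFunctionField_algebraMap_stalk y b, h])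

/-- Sections are regular at the points of their domain. [folklore] -/
theorem isRegularAt_algebraMap_sections (y : V) (a : Γ(X, V)) :
    IsRegularAt (y : X) (algebraMap Γ(X, V) X.functionField a) := by
  rw [← toFunctionField_algebraMap_stalk y]
  exact ⟨_, rfl⟩

/-- **A section `a ∈ Γ(X, V)` is a unit at `y ∈ V` iff `a ∉ 𝔭_y`** (`𝒪_{X,y} = S_{𝔭_y}`,
Görtz–Wedhorn I, (2.10.2)). [folklore] -/
theorem isUnitAt_algebraMap_iff (y : V) (a : Γ(X, V)) :
    IsUnitAt (y : X) (algebraMap Γ(X, V) X.functionField a) ↔ a ∉ (hV.primeIdealOf y).asIdeal := by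
  haveI := hV.isLocalization_stalk y
  rw [← toFunctionField_algebraMap_stalk y, isUnitAt_toFunctionField_iff,
    IsLocalization.AtPrime.isUnit_to_map_iff (X.presheaf.stalk y) (hV.primeIdealOf y).asIdeal a]
  rfl

/-- A section outside `𝔭_y` is a nonzero rational function. [folklore] -/
theorem algebraMap_ne_zero_of_notMem {y : V} {b : Γ(X, V)} (hb : b ∉ (hV.primeIdealOf y).asIdeal) :
    algebraMap Γ(X, V) X.functionField b ≠ 0 :=
  ((isUnitAt_algebraMap_iff hV y b).2 hb).ne_zero

/-- **`h ∈ K(X)` is regular at `y ∈ V` iff `h = a / b` with `a, b ∈ Γ(X, V)`, `b ∉ 𝔭_y`**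
(`𝒪_{X,y} = S_{𝔭_y} ⊆ K(X)`, Görtz–Wedhorn I, (2.10.2) and Prop. 3.29 (1)). [folklore] -/
theorem isRegularAt_iff_exists (y : V) (h : X.functionField) :
    IsRegularAt (y : X) h ↔ ∃ a b : Γ(X, V), b ∉ (hV.primeIdealOf y).asIdeal ∧
      h * algebraMap Γ(X, V) X.functionField b = algebraMap Γ(X, V) X.functionField a := by
  haveI := hV.isLocalization_stalk y
  constructor
  · rintro ⟨t, rfl⟩
    obtain ⟨⟨a, b⟩, e⟩ := IsLocalization.surj (hV.primeIdealOf y).asIdeal.primeCompl t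
    refine ⟨a, b, b.2, ?_⟩
    have e' := congrArg (toFunctionField (y : X)) e
    rwa [map_mul, toFunctionField_algebraMap_stalk, toFunctionField_algebraMap_stalk] at e'
  · rintro ⟨a, b, hb, e⟩
    refine ⟨IsLocalization.mk' (X.presheaf.stalk y) a
      (⟨b, hb⟩ : (hV.primeIdealOf y).asIdeal.primeCompl), ?_⟩
    apply mul_right_cancel₀ (algebraMap_ne_zero_of_notMem hV hb)
    rw [e, ← toFunctionField_algebraMap_stalk y b, ← map_mul, IsLocalization.mk'_spec,
      toFunctionField_algebraMap_stalk]

/-- A quotient `a / b` of sections with `b ∉ 𝔭_y` is regular at `y`. [folklore] -/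
theorem isRegularAt_div (y : V) (a : Γ(X, V)) {b : Γ(X, V)} (hb : b ∉ (hV.primeIdealOf y).asIdeal) :
    IsRegularAt (y : X) (algebraMap Γ(X, V) X.functionField a / algebraMap Γ(X, V) X.functionField b) :=
  (isRegularAt_iff_exists hV y _).2 ⟨a, b, hb, div_mul_cancel₀ _ (algebraMap_ne_zero_of_notMem hV hb)⟩

/-- Restriction to a smaller open does not change the rational function of a section. [folklore] -/
theorem algebraMap_map {W : X.Opens} [Nonempty W] (hWV : W ≤ V) (a : Γ(X, V)) :
    algebraMap Γ(X, W) X.functionField (X.presheaf.map (homOfLE hWV).op a) =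
      algebraMap Γ(X, V) X.functionField a := by
  change X.germToFunctionField W _ = X.germToFunctionField V a
  exact X.presheaf.germ_res_apply (homOfLE hWV) _ _ a

end Sections

/-! ### Points and primes along a smaller affine open -/

omit [IsIntegral X] in
/-- **Points versus primes along a smaller affine open** `W ⊆ V`: the point of `V` given by the
contraction of a prime `Q ⊂ Γ(X, W)` is the point of `W` given by `Q` (naturality of
`fromSpec`, Mathlib `IsAffineOpen.map_fromSpec`). [folklore] -/
theorem fromSpec_comap {W : X.Opens} (hW : IsAffineOpen W) (hWV : W ≤ V)
    (Q : PrimeSpectrum Γ(X, W)) :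
    hV.fromSpec (PrimeSpectrum.comap (X.presheaf.map (homOfLE hWV).op).hom Q) = hW.fromSpec Q := by
  rw [← hV.map_fromSpec hW (homOfLE hWV).op, Scheme.Hom.comp_apply, Spec.map_apply]

/-! ### Closed subsets and their radical ideals on an affine chart -/

set_option backward.isDefEq.respectTransparency false in
omit [IsIntegral X] in
/-- For a closed `Z ⊆ X` and a prime `q ⊂ Γ(X, V)`: the radical ideal `J_V(Z) = I(Z ∩ V)` of `Z`
on the chart (Mathlib `(Scheme.IdealSheafData.vanishingIdeal Z).ideal ⟨V, hV⟩`, the vanishing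
ideal of the preimage of `Z` in `Spec Γ(X, V)`) satisfies `J_V(Z) ⊆ q` iff the point of `q` lies
in `Z` (Görtz–Wedhorn I, Prop. 2.3 (2): `V(I(Y)) = Ȳ = Y` for closed `Y`).
[cite: GortzWedhorn2020, Prop. 2.3 (2)] -/
theorem vanishingIdeal_ideal_le_iff (Z : Closeds X) (q : PrimeSpectrum Γ(X, V)) :
    (Scheme.IdealSheafData.vanishingIdeal Z).ideal ⟨V, hV⟩ ≤ q.asIdeal ↔ hV.fromSpec q ∈ Z := by
  have hc : IsClosed (hV.fromSpec ⁻¹' (Z : Set X)) := Z.isClosed.preimage hV.fromSpec.continuous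
  rw [Scheme.IdealSheafData.vanishingIdeal_ideal, ← SetLike.coe_subset_coe,
    ← PrimeSpectrum.mem_zeroLocus, PrimeSpectrum.zeroLocus_vanishingIdeal_eq_closure]
  change q ∈ closure (hV.fromSpec ⁻¹' (Z : Set X)) ↔ _
  rw [hc.closure_eq, Set.mem_preimage]
  rfl

omit [IsIntegral X] in
/-- For a closed `Z ⊆ X` and `y ∈ V`: `J_V(Z) ⊆ 𝔭_y` iff `y ∈ Z`. [cite: GortzWedhorn2020, Prop. 2.3 (2)] -/
theorem vanishingIdeal_ideal_le_primeIdealOf_iff (Z : Closeds X) (y : V) :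
    (Scheme.IdealSheafData.vanishingIdeal Z).ideal ⟨V, hV⟩ ≤ (hV.primeIdealOf y).asIdeal ↔
      (y : X) ∈ Z := by
  rw [vanishingIdeal_ideal_le_iff hV Z, hV.fromSpec_primeIdealOf]

set_option backward.isDefEq.respectTransparency false in
omit [IsIntegral X] in
/-- `J_V(Z)` is a radical ideal. [folklore] -/
theorem isRadical_vanishingIdeal_ideal (Z : Closeds X) :
    ((Scheme.IdealSheafData.vanishingIdeal Z).ideal ⟨V, hV⟩).IsRadical := by
  rw [Scheme.IdealSheafData.vanishingIdeal_ideal]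
  exact PrimeSpectrum.isRadical_vanishingIdeal _

/-! ### Membership in a smaller affine open from regularity of all its sections -/

include hV in
/-- **If every section over the affine open `W ⊆ V` is regular at `y ∈ V`, then `y ∈ W`.**
All of `Γ(X, W)` then lies in `𝒪_{X,y} ⊆ K(X)`; the non-units at `y` form a prime `Q ⊂ Γ(X, W)`
lying over `𝔭_y ⊂ Γ(X, V)`, and the point of `Q` — a point of `W` — is `y`. (This is the affine
form of: a morphism `Spec 𝒪_{X,y} → W` compatible with `Spec 𝒪_{X,y} → X` forces `y ∈ W`.)
[folklore] -/
theorem mem_of_forall_isRegularAt [Nonempty V] {W : X.Opens} (hW : IsAffineOpen W) [Nonempty W]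
    (hWV : W ≤ V) (y : V)
    (h : ∀ s : Γ(X, W), IsRegularAt (y : X) (algebraMap Γ(X, W) X.functionField s)) :
    (y : X) ∈ W := by
  haveI := hV.isLocalization_stalk y
  -- the ring map `Γ(X, W) → 𝒪_{X,y}` through `K(X)`
  choose φ hφ using h
  have hφ_mul : ∀ s t, φ (s * t) = φ s * φ t := fun s t =>
    toFunctionField_injective (y : X) (by rw [map_mul, hφ, hφ, hφ, map_mul])
  have hφ_add : ∀ s t, φ (s + t) = φ s + φ t := fun s t =>
    toFunctionField_injective (y : X) (by rw [map_add, hφ, hφ, hφ, map_add])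
  have hφ_one : φ 1 = 1 := toFunctionField_injective (y : X) (by rw [hφ, map_one, map_one])
  have hφ_zero : φ 0 = 0 := toFunctionField_injective (y : X) (by rw [hφ, map_zero, map_zero])
  let Φ : Γ(X, W) →+* X.presheaf.stalk y :=
    { toFun := φ, map_one' := hφ_one, map_mul' := hφ_mul, map_zero' := hφ_zero, map_add' := hφ_add }
  -- compatibility with restriction from `V`
  have hres : ∀ a : Γ(X, V), Φ (X.presheaf.map (homOfLE hWV).op a) =
      algebraMap Γ(X, V) (X.presheaf.stalk y) a := fun a =>
    toFunctionField_injective (y : X) (by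
      change toFunctionField _ (φ _) = _
      rw [hφ, algebraMap_map hWV, toFunctionField_algebraMap_stalk])
  -- the prime of non-units at `y`
  let Q : PrimeSpectrum Γ(X, W) :=
    ⟨(IsLocalRing.maximalIdeal (X.presheaf.stalk y)).comap Φ, Ideal.IsPrime.comap Φ⟩
  have hQ : PrimeSpectrum.comap (X.presheaf.map (homOfLE hWV).op).hom Q = hV.primeIdealOf y := by
    ext a
    change Φ (X.presheaf.map (homOfLE hWV).op a) ∈ IsLocalRing.maximalIdeal _ ↔ _
    rw [hres, IsLocalization.AtPrime.to_map_mem_maximal_iff (X.presheaf.stalk y)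
      (hV.primeIdealOf y).asIdeal a]
  have e : hW.fromSpec Q = y := by
    rw [← fromSpec_comap hV hW hWV Q, hQ, hV.fromSpec_primeIdealOf]
  rw [← e]
  exact FieldNorm.fromSpec_mem hW Q

end Literature.AlgebraicGeometry.Motives.RatFn

end
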